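import Literature.MathematicalPhysics.QuantumLattice.HubbardOneParticleCost
import Literature.MathematicalPhysics.QuantumLattice.FinDimSpectrumSectorGibbsLimit

/-!
# Route `CooperPairDMottWalk`, crux `CooperPairDMott` (stmt-HubbardSuperconductivity-1177):
# the commutator trial-state bound and the best-block averaging step (linear algebra)

Support file for the stub `stub_pairTrialCeiling` (the two-hole level of the breathing torus from
above). Both halves of the variational argument are finite-dimensional linear algebra over `ℂⁿ`
with the pairing `star ψ ⬝ᵥ φ`:

* **commutator trial states** (`mulVec_trial_eq`, `re_rayleigh_trial_le`,
  `minEnergyOn_le_of_commutator_trial`): if `H Ω = E Ω` and `[H, A] = c A + R`, then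
  `H (A Ω) = (E + c) A Ω + R Ω`, so `Re ⟨AΩ, H AΩ⟩ ≤ (E + c) ‖AΩ‖² + ‖AΩ‖ ‖RΩ‖`, and for Hermitian
  `H` and `0 ≠ AΩ ∈ K` the sector energy obeys `minEnergyOn H K ≤ E + c + ‖RΩ‖ / ‖AΩ‖`
  (variational principle, `minEnergyOn_le_rayleigh_of_mem`);
* **averaging over blocks** (`re_form_le_of_posSemidef`, `sum_defect_le_of_forms`,
  `exists_defect_le_of_forms`): if `Q_m ≥ γ (1 - P_m)` as quadratic forms for `m ∈ s`, `γ > 0`,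
  then `Σ_m (‖Ω‖² - Re⟨Ω, P_m Ω⟩) ≤ Re⟨Ω, (Σ_m Q_m) Ω⟩ / γ`, and some block `m` has defect
  `‖Ω‖² - Re⟨Ω, P_m Ω⟩ ≤ Re⟨Ω, (Σ_m Q_m) Ω⟩ / (γ |s|)` (pigeonhole).

References: H. Tasaki, *Physics and Mathematics of Quantum Many-Body Systems* (2020), §2.1–2.2
(variational principle); the commutator form of the trial-state estimate is the standard
single-mode / Bijl–Feynman argument. All statements are [folklore]; no definition is introduced.
-/

set_option linter.dupNamespace false

noncomputable section

namespace Summit.HubbardSuperconductivity.HubbardSuperconductivity.Theorems.CooperPairDMottWalk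

open Matrix Finset Literature.MathematicalPhysics.QuantumLattice
open Literature.MathematicalPhysics.QuantumLattice.ThermodynamicLimit
  (star_dotProduct_eq_inner norm_toLp_sq star_dotProduct_self_eq_re)
open scoped ComplexOrder Matrix.Norms.L2Operator InnerProductSpace

variable {n : Type*} [Fintype n] [DecidableEq n]

/-! ### Commutator trial states -/

omit [DecidableEq n] in
/-- If `H Ω = E Ω` and `[H, A] = c A + R` then `H (A Ω) = (E + c) A Ω + R Ω`. [folklore] -/
theorem mulVec_trial_eq (H A R : Matrix n n ℂ) (Ω : n → ℂ) (E c : ℂ) (hΩ : H *ᵥ Ω = E • Ω)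
    (hcomm : H * A - A * H = c • A + R) : H *ᵥ (A *ᵥ Ω) = (E + c) • (A *ᵥ Ω) + R *ᵥ Ω := by
  have h1 : H * A = A * H + (c • A + R) := by rw [← hcomm]; abel
  calc H *ᵥ (A *ᵥ Ω) = (H * A) *ᵥ Ω := by rw [mulVec_mulVec]
    _ = (A * H + (c • A + R)) *ᵥ Ω := by rw [h1]
    _ = A *ᵥ (H *ᵥ Ω) + c • (A *ᵥ Ω) + R *ᵥ Ω := by
        rw [add_mulVec, add_mulVec, smul_mulVec, mulVec_mulVec, add_assoc]
    _ = (E + c) • (A *ᵥ Ω) + R *ᵥ Ω := by rw [hΩ, mulVec_smul, add_smul]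

omit [DecidableEq n] in
/-- The energy of a commutator trial state: `⟨AΩ, H AΩ⟩ = (E + c) ‖AΩ‖² + ⟨AΩ, RΩ⟩`. [folklore] -/
theorem rayleigh_trial_eq (H A R : Matrix n n ℂ) (Ω : n → ℂ) (E c : ℂ) (hΩ : H *ᵥ Ω = E • Ω)
    (hcomm : H * A - A * H = c • A + R) :
    star (A *ᵥ Ω) ⬝ᵥ (H *ᵥ (A *ᵥ Ω)) =
      (E + c) * (star (A *ᵥ Ω) ⬝ᵥ (A *ᵥ Ω)) + star (A *ᵥ Ω) ⬝ᵥ (R *ᵥ Ω) := by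
  rw [mulVec_trial_eq H A R Ω E c hΩ hcomm, dotProduct_add, dotProduct_smul, smul_eq_mul]

omit [DecidableEq n] in
/-- **The commutator trial-state bound**: `Re ⟨AΩ, H AΩ⟩ ≤ (E + c) ‖AΩ‖² + ‖AΩ‖ ‖RΩ‖`
(Cauchy–Schwarz on the remainder). [folklore] -/
theorem re_rayleigh_trial_le (H A R : Matrix n n ℂ) (Ω : n → ℂ) (E c : ℝ)
    (hΩ : H *ᵥ Ω = (E : ℂ) • Ω) (hcomm : H * A - A * H = (c : ℂ) • A + R) :
    (star (A *ᵥ Ω) ⬝ᵥ (H *ᵥ (A *ᵥ Ω))).re ≤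
      (E + c) * (star (A *ᵥ Ω) ⬝ᵥ (A *ᵥ Ω)).re +
        ‖(WithLp.toLp 2 (A *ᵥ Ω) : EuclideanSpace ℂ n)‖ *
          ‖(WithLp.toLp 2 (R *ᵥ Ω) : EuclideanSpace ℂ n)‖ := by
  rw [rayleigh_trial_eq H A R Ω E c hΩ hcomm, Complex.add_re, ← Complex.ofReal_add,
    Complex.re_ofReal_mul]
  refine add_le_add le_rfl ((Complex.re_le_norm _).trans ?_)
  rw [star_dotProduct_eq_inner]
  exact norm_inner_le_norm _ _

/-- **Variational conclusion of the commutator trial-state bound**: for Hermitian `H`, an eigenvector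
`H Ω = E Ω`, an operator with `[H, A] = c A + R`, and a subspace `K ∋ AΩ ≠ 0`,
`minEnergyOn H K ≤ E + c + ‖RΩ‖ / ‖AΩ‖`. [folklore] -/
theorem minEnergyOn_le_of_commutator_trial {H A R : Matrix n n ℂ} (hH : H.IsHermitian) {Ω : n → ℂ}
    {E c : ℝ} (hΩ : H *ᵥ Ω = (E : ℂ) • Ω) (hcomm : H * A - A * H = (c : ℂ) • A + R)
    (K : Submodule ℂ (n → ℂ)) (hK : A *ᵥ Ω ∈ K) (hne : A *ᵥ Ω ≠ 0) :
    H.minEnergyOn K ≤ E + c +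
      ‖(WithLp.toLp 2 (R *ᵥ Ω) : EuclideanSpace ℂ n)‖ /
        ‖(WithLp.toLp 2 (A *ᵥ Ω) : EuclideanSpace ℂ n)‖ := by
  set ψ := A *ᵥ Ω with hψ
  set r : ℝ := ‖(WithLp.toLp 2 ψ : EuclideanSpace ℂ n)‖ with hr
  have hr2 : r ^ 2 = (star ψ ⬝ᵥ ψ).re := norm_toLp_sq ψ
  have hψψ : 0 < (star ψ ⬝ᵥ ψ).re := (Complex.pos_iff.1 (dotProduct_star_self_pos_iff.2 hne)).1
  have hrpos : 0 < r := by
    have h2 : 0 < r ^ 2 := by rw [hr2]; exact hψψ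
    have h0 : 0 ≤ r := norm_nonneg _
    rcases h0.lt_or_eq with h | h
    · exact h
    · rw [← h] at h2; norm_num at h2
  -- the normalised trial vector
  set φ : n → ℂ := ((r : ℂ)⁻¹) • ψ with hφ
  have hφK : φ ∈ K := K.smul_mem _ hK
  have hcc : star ((r : ℂ)⁻¹) * (r : ℂ)⁻¹ = (((r ^ 2)⁻¹ : ℝ) : ℂ) := by
    rw [Complex.star_def, map_inv₀, Complex.conj_ofReal]
    push_cast
    rw [← mul_inv, sq]
  have hφ1 : star φ ⬝ᵥ φ = 1 := by
    rw [hφ, star_smul, smul_dotProduct, dotProduct_smul, smul_smul, hcc, star_dotProduct_self_eq_re ψ,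
      ← hr2, smul_eq_mul, ← Complex.ofReal_mul, inv_mul_cancel₀ (pow_ne_zero 2 hrpos.ne'),
      Complex.ofReal_one]
  have hle := minEnergyOn_le_rayleigh_of_mem hH K hφK hφ1
  have hray : (star φ ⬝ᵥ H *ᵥ φ).re = (r ^ 2)⁻¹ * (star ψ ⬝ᵥ (H *ᵥ ψ)).re := by
    rw [hφ, mulVec_smul, star_smul, smul_dotProduct, dotProduct_smul, smul_smul, hcc, smul_eq_mul,
      Complex.re_ofReal_mul]
  have hbound := re_rayleigh_trial_le H A R Ω E c hΩ hcomm
  rw [← hψ, ← hr, ← hr2] at hbound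
  rw [hray] at hle
  refine hle.trans ?_
  have hr2pos : 0 < r ^ 2 := by positivity
  rw [inv_mul_le_iff₀ hr2pos]
  have : r ^ 2 * (E + c + ‖(WithLp.toLp 2 (R *ᵥ Ω) : EuclideanSpace ℂ n)‖ / r) =
      (E + c) * r ^ 2 + r * ‖(WithLp.toLp 2 (R *ᵥ Ω) : EuclideanSpace ℂ n)‖ := by
    field_simp
  rw [this]
  exact hbound

/-! ### Averaging over blocks: quadratic-form defects -/

/-- A positive semidefinite difference `Q - γ (1 - P) ≥ 0` is the form inequality
`γ (‖v‖² - Re ⟨v, P v⟩) ≤ Re ⟨v, Q v⟩`. [folklore] -/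
theorem re_form_le_of_posSemidef {Q P : Matrix n n ℂ} {γ : ℝ}
    (h : (Q - (γ : ℂ) • (1 - P)).PosSemidef) (v : n → ℂ) :
    γ * ((star v ⬝ᵥ v).re - (star v ⬝ᵥ (P *ᵥ v)).re) ≤ (star v ⬝ᵥ (Q *ᵥ v)).re := by
  have h0 := h.dotProduct_mulVec_nonneg v
  rw [sub_mulVec, smul_mulVec, sub_mulVec, one_mulVec, dotProduct_sub, dotProduct_smul,
    dotProduct_sub, smul_eq_mul] at h0
  have h1 := (Complex.nonneg_iff.1 h0).1
  rw [Complex.sub_re, Complex.re_ofReal_mul, Complex.sub_re] at h1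
  linarith

omit [DecidableEq n] in
/-- **Summing the local defect inequalities**: if `γ (‖v‖² - Re⟨v, P_m v⟩) ≤ Re⟨v, Q_m v⟩` for all
`v` and all `m ∈ s` (`γ > 0`), then `Σ_{m ∈ s} (‖Ω‖² - Re⟨Ω, P_m Ω⟩) ≤ Re⟨Ω, (Σ_m Q_m) Ω⟩ / γ`.
[folklore] -/
theorem sum_defect_le_of_forms {ι : Type*} (s : Finset ι) (Q P : ι → Matrix n n ℂ) {γ : ℝ}
    (hγ : 0 < γ)
    (hQP : ∀ m ∈ s, ∀ v : n → ℂ,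
      γ * ((star v ⬝ᵥ v).re - (star v ⬝ᵥ (P m *ᵥ v)).re) ≤ (star v ⬝ᵥ (Q m *ᵥ v)).re)
    (Ω : n → ℂ) :
    ∑ m ∈ s, ((star Ω ⬝ᵥ Ω).re - (star Ω ⬝ᵥ (P m *ᵥ Ω)).re) ≤
      (star Ω ⬝ᵥ ((∑ m ∈ s, Q m) *ᵥ Ω)).re / γ := by
  rw [le_div_iff₀ hγ, sum_mulVec, dotProduct_sum, Complex.re_sum, Finset.sum_mul]
  refine Finset.sum_le_sum fun m hm => ?_
  rw [mul_comm]
  exact hQP m hm Ω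

omit [DecidableEq n] in
/-- **Pigeonhole over the blocks**: under the same hypotheses, if moreover
`Re⟨Ω, (Σ_m Q_m) Ω⟩ ≤ B`, some block `m ∈ s` has defect `‖Ω‖² - Re⟨Ω, P_m Ω⟩ ≤ B / (γ |s|)`.
[folklore] -/
theorem exists_defect_le_of_forms {ι : Type*} {s : Finset ι} (hs : s.Nonempty)
    (Q P : ι → Matrix n n ℂ) {γ : ℝ} (hγ : 0 < γ)
    (hQP : ∀ m ∈ s, ∀ v : n → ℂ,
      γ * ((star v ⬝ᵥ v).re - (star v ⬝ᵥ (P m *ᵥ v)).re) ≤ (star v ⬝ᵥ (Q m *ᵥ v)).re)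
    (Ω : n → ℂ) {B : ℝ} (hB : (star Ω ⬝ᵥ ((∑ m ∈ s, Q m) *ᵥ Ω)).re ≤ B) :
    ∃ m ∈ s, (star Ω ⬝ᵥ Ω).re - (star Ω ⬝ᵥ (P m *ᵥ Ω)).re ≤ B / (γ * s.card) := by
  have hcard : (0 : ℝ) < s.card := by exact_mod_cast hs.card_pos
  refine Finset.exists_le_of_sum_le hs ?_
  rw [Finset.sum_const, nsmul_eq_mul]
  refine (sum_defect_le_of_forms s Q P hγ hQP Ω).trans ?_
  rw [div_le_iff₀ hγ]
  calc (s.card : ℝ) * (B / (γ * s.card)) * γ = B := by field_simp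
    _ ≥ (star Ω ⬝ᵥ ((∑ m ∈ s, Q m) *ᵥ Ω)).re := hB

/-! ### Registered form -/

/-- **Registered sub-goal `pairTrialCeiling_trialStateBound`** (the commutator trial-state bound in
closed form, as registered on the crux item): for Hermitian `H`, `H Ω = E Ω`, `[H, A] = c A + R` and
`0 ≠ A Ω ∈ K`, `minEnergyOn H K ≤ E + c + ‖RΩ‖ / ‖AΩ‖`. [folklore] -/
theorem pairTrialCeiling_trialStateBound : ∀ {n : Type} [Fintype n] [DecidableEq n] {H A R : Matrix n n ℂ}, H.IsHermitian → ∀ {Ω : n → ℂ} {E c : ℝ}, H *ᵥ Ω = (E : ℂ) • Ω → H * A - A * H = (c : ℂ) • A + R → ∀ (K : Submodule ℂ (n → ℂ)), A *ᵥ Ω ∈ K → A *ᵥ Ω ≠ 0 → H.minEnergyOn K ≤ E + c + ‖(WithLp.toLp 2 (R *ᵥ Ω) : EuclideanSpace ℂ n)‖ / ‖(WithLp.toLp 2 (A *ᵥ Ω) : EuclideanSpace ℂ n)‖ :=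
  fun hH _ _ _ hΩ hcomm K hK hne => minEnergyOn_le_of_commutator_trial hH hΩ hcomm K hK hne

end Summit.HubbardSuperconductivity.HubbardSuperconductivity.Theorems.CooperPairDMottWalk

end
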